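import Summits.AnomalousDissipation.AnomalousDissipation.Theorems.SolenoidalFractalHomogenisationLagrangianStepW7DrainFloor
import HarnessLib

/-!
# K1L_D `stub_D1_V0thg` (stmt-AnomalousDissipation-27980), R3′ lane «SidebandTailCrushing» (tenure D28-16 (3)) — file F2:
# LADDER GEOMETRY — the signed-commutator sign and the uniform uncertainty constant, pointwise on `ℂ³`

Helper file of route `SolenoidalFractalHomogenisation` (prover seat `ad-k1l-cellLawV-w1` g10; plan memo
`Cruxes/LagrangianRenormalisationStepDesign/Lines/onelevel-vtheta-R3-plan.md` §3; `--supports stmt-AnomalousDissipation-27980 --as helper`).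

During slot `i` of the sideband system (`Sideband.genComp`) the link block from the fibre at `z` to the fibre at `z + mᵢ` is a scalar multiple of
`P_{z+m} P_z` (`P` = `Torus.transversalProj`, the Leray projection).  The three-term hypocoercivity lemma `LadderCrush.hypocoercive_decay` (file F1)
needs two pointwise facts about these blocks, for a transversal amplitude `w ⊥ z` (`kdot z w = 0`) on a hopping ladder (`z ∦ m`):
* (S) **the signed commutator** — `[C,B]` is site-diagonal with block `2|β|²·P_z(P_{z+m} − P_{z−m})P_z`, and
  `‖P_{z+m}w‖² − ‖P_{z−m}w‖² = |m·w|²·(1/|z−m|² − 1/|z+m|²)` has the sign of `z·m` (`|z+m|² − |z−m|² = 4 z·m`), i.e. the sign of the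
  half-integer site index `κ(z) = ⌊z·m/|m|²⌋ + 1/2`: `signed_site` (`0 ≤ κ·(z·m) → 0 ≤ κ·(‖P_{z+m}w‖² − ‖P_{z−m}w‖²)`);
* (U) **the uniform uncertainty constant** — `B*B + BB*` is site-diagonal with block `|β|²·P_z(P_{z+m} + P_{z−m})P_z`, and
  `‖P_{z+m}w‖² + ‖P_{z−m}w‖² ≥ (2|z|²/(|z|²+|m|²))·‖w‖²` for EVERY `z ≠ 0` (`uncertainty_site`; the coefficient of the tree's
  `W7Slot.drain_floor_pair` is bounded below UNIFORMLY: `drain_coeff_ge` ⇔ `2(z·m)²(|z|²−|m|²)² ≥ 0`), so no per-ladder ⊥-bond census is needed.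
Plus the norm comparisons `|z|² ≤ 2|z±m|² + 2|m|²` used for the local constants of F1's hypotheses (h2).  Pure finite-dimensional algebra on top of
`…W7DrainFloor` (`norm_sq_transversalProj`, `kdot_add_left/sub_left`, `drain_floor_pair`, `freqNormSq_add_three/sub_three`, `dot_sq_le_freqNormSq_mul`).
No definitions, no sorry, no named fact.  NOT a proof of `stub_D1_V0thg`, of K1L_D or of AD; rung F-D1.A0 infrastructure.
-/

set_option linter.dupNamespace false -- single-conjunct summit: `Summit.AnomalousDissipation.AnomalousDissipation.…` is the mandated namespace

namespace Summit.AnomalousDissipation.AnomalousDissipation.Theorems.SolenoidalFractalHomogenisation.LagrangianStep.LadderCrush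

open scoped InnerProductSpace
open Literature.Analysis.FluidPDE Literature.Analysis.FluidPDE.Torus
open Literature.Analysis.FunctionSpaces.Torus (freqNormSq freqNormSq_nonneg)
open Summit.AnomalousDissipation.AnomalousDissipation.Theorems.SolenoidalFractalHomogenisation.LagrangianStep.W7Slot
  (norm_sq_transversalProj kdot_add_left kdot_sub_left norm_kdot_sq_le_of_kdot_eq_zero drain_floor_pair freqNormSq_add_three
    freqNormSq_sub_three dot_sq_le_freqNormSq_mul)

noncomputable section

/-! ## §1 Lattice arithmetic along a ladder -/

/-- `|K+m|² − |K−m|² = 4 K·m` on `ℤ³`. [folklore] -/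
theorem freqNormSq_add_sub_freqNormSq_sub (K m : Fin 3 → ℤ) :
    freqNormSq (K + m) - freqNormSq (K - m) = 4 * ∑ i, (K i : ℝ) * m i := by
  rw [freqNormSq_add_three, freqNormSq_sub_three]; ring

/-- `|K|² ≤ 2|K + m|² + 2|m|²`. [folklore] -/
theorem freqNormSq_le_two_mul_add (K m : Fin 3 → ℤ) : freqNormSq K ≤ 2 * freqNormSq (K + m) + 2 * freqNormSq m := by
  rw [freqNormSq_add_three]
  have h : 0 ≤ freqNormSq (K + m + m) := freqNormSq_nonneg _
  rw [freqNormSq_add_three, freqNormSq_add_three] at h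
  have e : ∑ i, ((K + m) i : ℝ) * m i = ∑ i, (K i : ℝ) * m i + freqNormSq m := by
    simp only [Pi.add_apply, Int.cast_add, add_mul, Finset.sum_add_distrib, freqNormSq]
    congr 1
    exact Finset.sum_congr rfl fun i _ => by ring
  rw [e] at h
  nlinarith [freqNormSq_nonneg K, freqNormSq_nonneg m, dot_sq_le_freqNormSq_mul K m]

/-- `|K|² ≤ 2|K − m|² + 2|m|²`. [folklore] -/
theorem freqNormSq_le_two_mul_sub (K m : Fin 3 → ℤ) : freqNormSq K ≤ 2 * freqNormSq (K - m) + 2 * freqNormSq m := by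
  have h := freqNormSq_le_two_mul_add K (-m)
  rwa [Literature.Analysis.FunctionSpaces.Torus.freqNormSq_neg, ← sub_eq_add_neg] at h

/-- Off the line `ℝm` the two ladder neighbours have positive length: `(K·m)² < |K|²|m|² ⇒ 0 < |K ± m|²` (indeed `|K|²+|m|² > 2|K·m|`). [folklore] -/
theorem freqNormSq_add_pos_of_dot_sq_lt {K m : Fin 3 → ℤ} (h : (∑ i, (K i : ℝ) * m i) ^ 2 < freqNormSq K * freqNormSq m) :
    0 < freqNormSq (K + m) ∧ 0 < freqNormSq (K - m) := by
  rw [freqNormSq_add_three, freqNormSq_sub_three]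
  have hK := freqNormSq_nonneg K
  have hm := freqNormSq_nonneg m
  constructor <;> nlinarith [sq_nonneg (freqNormSq K - freqNormSq m), sq_nonneg (freqNormSq K + freqNormSq m),
    sq_abs (∑ i, (K i : ℝ) * m i), abs_nonneg (∑ i, (K i : ℝ) * m i)]

/-! ## §2 (S) The signed commutator, per site -/

/-- **Signed difference of the two neighbour projections** for a transversal amplitude:
`‖P_{K₀+m} z‖² − ‖P_{K₀−m} z‖² = |m·z|²·(1/|K₀−m|² − 1/|K₀+m|²)` (`z ⊥ K₀`; Lean's `1/0 = 0` covers `K₀ ± m = 0`).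
[cite: BedrossianCotiZelati2017, §2 (hypocoercivity functional: the commutator term)] -/
theorem norm_sq_transversalProj_add_sub_sub (K0 m : Fin 3 → ℤ) {z : EuclideanSpace ℂ (Fin 3)} (hz : kdot K0 z = 0) :
    ‖transversalProj (K0 + m) z‖ ^ 2 - ‖transversalProj (K0 - m) z‖ ^ 2
      = ‖kdot m z‖ ^ 2 * (1 / freqNormSq (K0 - m) - 1 / freqNormSq (K0 + m)) := by
  have hp : kdot (K0 + m) z = kdot m z := by rw [kdot_add_left, hz, zero_add]
  have hm : kdot (K0 - m) z = -kdot m z := by rw [kdot_sub_left, hz, zero_sub]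
  rw [norm_sq_transversalProj, norm_sq_transversalProj, hp, hm, norm_neg]
  ring

/-- **(S) THE SIGNED-COMMUTATOR SIGN.**  On a hopping ladder (`K₀ ± m ≠ 0`), for `z ⊥ K₀` and any real weight `κ` with the sign of `K₀·m`
(`0 ≤ κ·(K₀·m)`, e.g. the half-integer site index `κ = ⌊K₀·m/|m|²⌋ + 1/2`): `0 ≤ κ·(‖P_{K₀+m}z‖² − ‖P_{K₀−m}z‖²)`.  Indeed the difference equals
`4(K₀·m)|m·z|²/(|K₀+m|²|K₀−m|²)`. [cite: BedrossianCotiZelati2017, §2 (hypocoercivity functional: the commutator term)] -/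
theorem signed_site {K0 m : Fin 3 → ℤ} (hp : K0 + m ≠ 0) (hm : K0 - m ≠ 0) {z : EuclideanSpace ℂ (Fin 3)} (hz : kdot K0 z = 0)
    {κ : ℝ} (hκ : 0 ≤ κ * ∑ i, (K0 i : ℝ) * m i) :
    0 ≤ κ * (‖transversalProj (K0 + m) z‖ ^ 2 - ‖transversalProj (K0 - m) z‖ ^ 2) := by
  have hFp : 0 < freqNormSq (K0 + m) := freqNormSq_pos_of_ne_zero' hp
  have hFm : 0 < freqNormSq (K0 - m) := freqNormSq_pos_of_ne_zero' hm
  rw [norm_sq_transversalProj_add_sub_sub K0 m hz]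
  have hdiff : 1 / freqNormSq (K0 - m) - 1 / freqNormSq (K0 + m)
      = (4 * ∑ i, (K0 i : ℝ) * m i) / (freqNormSq (K0 + m) * freqNormSq (K0 - m)) := by
    rw [← freqNormSq_add_sub_freqNormSq_sub, div_sub_div _ _ hFm.ne' hFp.ne', one_mul, mul_one, mul_comm]
  rw [hdiff]
  have hT : 0 ≤ ‖kdot m z‖ ^ 2 := sq_nonneg _
  have hden : 0 < freqNormSq (K0 + m) * freqNormSq (K0 - m) := mul_pos hFp hFm
  have e : κ * (‖kdot m z‖ ^ 2 * (4 * (∑ i, (K0 i : ℝ) * m i) / (freqNormSq (K0 + m) * freqNormSq (K0 - m))))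
      = 4 * (κ * ∑ i, (K0 i : ℝ) * m i) * ‖kdot m z‖ ^ 2 / (freqNormSq (K0 + m) * freqNormSq (K0 - m)) := by ring
  rw [e]
  positivity

/-! ## §3 (U) The uniform uncertainty constant, per site -/

/-- **The drain coefficient is uniformly bounded below**: for `K₀ ≠ 0`,
`2|K₀|²/(|K₀|² + |m|²) ≤ 2 − |m_⊥|²·(1/|K₀+m|² + 1/|K₀−m|²)`, `|m_⊥|² = |m|² − (K₀·m)²/|K₀|²`
(with `p = |K₀|², q = K₀·m, r = |m|²` the difference is `2q²(p−r)²/(p(p+r)((p+r)²−4q²))`; the colinear case `q² = pr` gives `|m_⊥|² = 0`).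
The tree's `W7Slot.drain_floor_coeff_lower` vanishes at `K₀·m = 0`; this bound does not. [cite: BedrossianCotiZelati2017, §2 (spectral gap / uncertainty step)] -/
theorem drain_coeff_ge {K0 : Fin 3 → ℤ} (hK0 : K0 ≠ 0) (m : Fin 3 → ℤ) :
    2 * freqNormSq K0 / (freqNormSq K0 + freqNormSq m)
      ≤ 2 - (freqNormSq m - (∑ i, (K0 i : ℝ) * m i) ^ 2 / freqNormSq K0)
          * (1 / freqNormSq (K0 + m) + 1 / freqNormSq (K0 - m)) := by
  set p : ℝ := freqNormSq K0 with hpdef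
  set r : ℝ := freqNormSq m with hrdef
  set q : ℝ := ∑ i, (K0 i : ℝ) * m i with hqdef
  have hp : 0 < p := freqNormSq_pos_of_ne_zero' hK0
  have hr : 0 ≤ r := freqNormSq_nonneg m
  have hcs : q ^ 2 ≤ p * r := dot_sq_le_freqNormSq_mul K0 m
  have hFp : freqNormSq (K0 + m) = p + 2 * q + r := freqNormSq_add_three K0 m
  have hFm : freqNormSq (K0 - m) = p - 2 * q + r := freqNormSq_sub_three K0 m
  have hlhs_le : 2 * p / (p + r) ≤ 2 := by
    rw [div_le_iff₀ (by positivity)]; linarith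
  rcases hcs.lt_or_eq with hlt | heq
  · -- non-colinear: both neighbours nonzero
    have hA : 0 < p + 2 * q + r := by rw [← hFp]; exact (freqNormSq_add_pos_of_dot_sq_lt hlt).1
    have hB : 0 < p - 2 * q + r := by rw [← hFm]; exact (freqNormSq_add_pos_of_dot_sq_lt hlt).2
    rw [hFp, hFm]
    have key : 2 - (r - q ^ 2 / p) * (1 / (p + 2 * q + r) + 1 / (p - 2 * q + r)) - 2 * p / (p + r)
        = 2 * q ^ 2 * (p - r) ^ 2 / (p * (p + r) * ((p + 2 * q + r) * (p - 2 * q + r))) := by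
      field_simp
      ring
    have hkey : 0 ≤ 2 * q ^ 2 * (p - r) ^ 2 / (p * (p + r) * ((p + 2 * q + r) * (p - 2 * q + r))) := by positivity
    linarith
  · -- colinear: `|m_⊥|² = 0`
    have hM : r - q ^ 2 / p = 0 := by rw [heq, mul_div_cancel_left₀ r hp.ne', sub_self]
    rw [hM, zero_mul, sub_zero]
    exact hlhs_le

/-- **(U) THE UNIFORM UNCERTAINTY CONSTANT, per site.**  For `K₀ ≠ 0` and `z ⊥ K₀`:
`(2|K₀|²/(|K₀|² + |m|²))·‖z‖² ≤ ‖P_{K₀+m} z‖² + ‖P_{K₀−m} z‖²`; in particular `≥ (2/(1+|m|²))‖z‖²` on the lattice (`|K₀|² ≥ 1`).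
[cite: BedrossianCotiZelati2017, §2 (spectral gap / uncertainty step)] -/
theorem uncertainty_site {K0 : Fin 3 → ℤ} (hK0 : K0 ≠ 0) (m : Fin 3 → ℤ) {z : EuclideanSpace ℂ (Fin 3)} (hz : kdot K0 z = 0) :
    2 * freqNormSq K0 / (freqNormSq K0 + freqNormSq m) * ‖z‖ ^ 2
      ≤ ‖transversalProj (K0 + m) z‖ ^ 2 + ‖transversalProj (K0 - m) z‖ ^ 2 :=
  le_trans (mul_le_mul_of_nonneg_right (drain_coeff_ge hK0 m) (sq_nonneg _)) (drain_floor_pair K0 m hz)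

/-- The lattice form of (U): `|K₀|² ≥ 1` gives the `K₀`-free constant `2/(1 + |m|²)`. [cite: BedrossianCotiZelati2017, §2] -/
theorem uncertainty_site_lattice {K0 : Fin 3 → ℤ} (hK0 : K0 ≠ 0) (m : Fin 3 → ℤ) {z : EuclideanSpace ℂ (Fin 3)} (hz : kdot K0 z = 0) :
    2 / (1 + freqNormSq m) * ‖z‖ ^ 2 ≤ ‖transversalProj (K0 + m) z‖ ^ 2 + ‖transversalProj (K0 - m) z‖ ^ 2 := by
  refine le_trans (mul_le_mul_of_nonneg_right ?_ (sq_nonneg _)) (uncertainty_site hK0 m hz)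
  have hp : 1 ≤ freqNormSq K0 := by
    obtain ⟨i, hi⟩ : ∃ i, K0 i ≠ 0 := by
      by_contra h
      push Not at h
      exact hK0 (funext h)
    have h1 : (1 : ℝ) ≤ (K0 i : ℝ) ^ 2 := by
      have : (1 : ℤ) ≤ K0 i ^ 2 := by nlinarith [Int.one_le_abs hi, sq_abs (K0 i)]
      exact_mod_cast this
    have h2 : (K0 i : ℝ) ^ 2 ≤ freqNormSq K0 := by
      rw [freqNormSq]
      exact Finset.single_le_sum (f := fun j => (K0 j : ℝ) ^ 2) (fun j _ => sq_nonneg _) (Finset.mem_univ i)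
    exact h1.trans h2
  have hr : 0 ≤ freqNormSq m := freqNormSq_nonneg m
  rw [div_le_div_iff₀ (by positivity) (by positivity)]
  nlinarith

/-! ## §4 The per-site block bounds used for F1's local constants -/

/-- `‖P_{K₀+m} z‖² + ‖P_{K₀−m} z‖² ≤ 2‖z‖²` (projections are contractions). [cite: Temam1984, Ch. III §1.1] -/
theorem norm_sq_transversalProj_add_add_le (K0 m : Fin 3 → ℤ) (z : EuclideanSpace ℂ (Fin 3)) :
    ‖transversalProj (K0 + m) z‖ ^ 2 + ‖transversalProj (K0 - m) z‖ ^ 2 ≤ 2 * ‖z‖ ^ 2 := by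
  rw [norm_sq_transversalProj, norm_sq_transversalProj]
  have h1 : 0 ≤ ‖kdot (K0 + m) z‖ ^ 2 / freqNormSq (K0 + m) := div_nonneg (sq_nonneg _) (freqNormSq_nonneg _)
  have h2 : 0 ≤ ‖kdot (K0 - m) z‖ ^ 2 / freqNormSq (K0 - m) := div_nonneg (sq_nonneg _) (freqNormSq_nonneg _)
  linarith

end

end Summit.AnomalousDissipation.AnomalousDissipation.Theorems.SolenoidalFractalHomogenisation.LagrangianStep.LadderCrush
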